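import Mathlib
import Summits.ValiantsHypothesis.ValiantsHypothesis.Theses.FreeSubtorus
import Summits.ValiantsHypothesis.ValiantsHypothesis.Cruxes.OrbitDimensionBound.Lines.DepthLadder

/-!
# `filtered_covering_onpath` — F4: `S → Rung` for the rung `Depth.FilteredShadow` (kernel-checked, no sorry)

`ValiantsHypothesis → FilteredShadow` is `Depth.filteredShadow_of_summit` (ladder, tagged `aesop` safe) /
`Depth.FilteredShadow_of_ValiantsHypothesis`; indeed `ValiantsHypothesis → DepthShadow q` for every `q : ℕ∞`.
-/

open Summit.ValiantsHypothesis.ValiantsHypothesis.Cruxes.OrbitDimensionBound.Depth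

namespace Summit.ValiantsHypothesis.ValiantsHypothesis.Cruxes.OrbitDimensionBound.Depth.OnPath

/-- F4 on-path lemma, by automation (the tribunal's tactic). [cite: LandsbergRessayre2017, Question 2.2] -/
example : _root_.ValiantsHypothesis → FilteredShadow := by
  intro h; aesop

/-- F4 on-path lemma, by name. [cite: LandsbergRessayre2017, Question 2.2] -/
theorem FilteredShadow_onpath : _root_.ValiantsHypothesis → FilteredShadow :=
  FilteredShadow_of_ValiantsHypothesis

/-- Every notch of the shadow dial is on path. [cite: Burgisser2000, Thm. 2.10] -/
example (q : ℕ∞) : _root_.ValiantsHypothesis → DepthShadow q := depthShadow_of_summit q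

/-- The top's shadow too. [cite: King1994, Thm. 4.1] -/
example : _root_.ValiantsHypothesis → PolystableShadow := polystableShadow_of_summit

end Summit.ValiantsHypothesis.ValiantsHypothesis.Cruxes.OrbitDimensionBound.Depth.OnPath
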